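import Mathlib

/-!
# The cyclic Hölder / chessboard inequality for traces of alternating words of odd length
(stub `stub_cyclicHolder` of line `Sketch`, crux `QuarksAsStableAction.WilsonQuarkStability`,
item stmt-QuantumFields-9736; lead prover-line-stmt-QuantumFields-9736-c2-0)

For positive definite `T_i` and unitary `u_i` (`i ∈ ℤ/L`, `L` odd),
`‖Tr (T_0 u_0 T_1 u_1 ⋯ T_{L-1} u_{L-1})‖^L ≤ ∏_i Re Tr T_i^L`.
This is the generalised Hölder inequality for Schatten norms specialised to alternating positive/unitary
letters; it is derived here from the two registered stubs of the line taken as hypotheses — the mixed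
reflection (Cauchy–Schwarz) step `h1` and the abstract chessboard-from-reflection maximiser argument `h2` —
instantiated at the letters `T_i` (indexed by `ZMod L` itself) and `1, u_i, u_iᴴ`
(indexed by `Option (ZMod L × Bool)`), together with the rotation invariance of the trace of a cyclic word.
Its extremal words are homogeneous (`T, 1, T, 1, …`), i.e. period ONE, which is why no parity of `L` is forced.
References: J. Fröhlich, R. Israel, E. H. Lieb, B. Simon, Commun. Math. Phys. 62 (1978) 1, Thm. 4.1;
B. Simon, *Trace ideals and their applications*, Thm. 2.8.  Pure theorem file (no definitions).
-/

namespace Summit.QuantumFields.QCD.Cruxes.WilsonQuarkStability.FreeTangentLandauChessboard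

open Matrix
open scoped ComplexOrder

namespace CyclicHolder

/-- Rotating a cyclic word does not change the trace of its product:
`Tr ∏_{i<N} X_{i+1} = Tr ∏_{i<N} X_i` for letters indexed by `ZMod N`. -/
theorem trace_prod_map_range_succ {k : Type} [Fintype k] [DecidableEq k] {N : ℕ} [NeZero N]
    (X : ZMod N → Matrix k k ℂ) :
    ((List.range N).map fun i : ℕ => X ((i : ZMod N) + 1)).prod.trace =
      ((List.range N).map fun i : ℕ => X (i : ZMod N)).prod.trace := by
  obtain ⟨m, rfl⟩ := Nat.exists_eq_succ_of_ne_zero (NeZero.ne N)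
  have hl : ((List.range (m + 1)).map fun i : ℕ => X ((i : ZMod (m + 1)) + 1)) =
      ((List.range m).map fun i : ℕ => X ((i + 1 : ℕ) : ZMod (m + 1))) ++ [X ((0 : ℕ) : ZMod (m + 1))] := by
    rw [List.range_succ, List.map_append, List.map_singleton]
    congr 1
    · refine List.map_congr_left fun i _ => ?_
      push_cast; rfl
    · congr 1
      have : ((m : ℕ) : ZMod (m + 1)) + 1 = ((0 : ℕ) : ZMod (m + 1)) := by
        rw [← Nat.cast_succ, ZMod.natCast_self, Nat.cast_zero]
      rw [this]
  have hr : ((List.range (m + 1)).map fun i : ℕ => X (i : ZMod (m + 1))) =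
      X ((0 : ℕ) : ZMod (m + 1)) :: ((List.range m).map fun i : ℕ => X ((i + 1 : ℕ) : ZMod (m + 1))) := by
    rw [List.range_succ_eq_map, List.map_cons, List.map_map]
    rfl
  rw [hl, hr, List.prod_append, List.prod_singleton, List.prod_cons, Matrix.trace_mul_comm]

/-- The trace of a positive semidefinite complex matrix is a non-negative real: `‖Tr A‖ = Re Tr A`. -/
theorem norm_trace_eq_re_of_posSemidef {k : Type} [Fintype k] [DecidableEq k] {A : Matrix k k ℂ}
    (hA : A.PosSemidef) : ‖A.trace‖ = A.trace.re := by
  have h := hA.trace_nonneg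
  rw [Complex.nonneg_iff] at h
  have hz : A.trace = ((A.trace.re : ℝ) : ℂ) := Complex.ext rfl (by simpa using h.2.symm)
  rw [hz, Complex.norm_real, Real.norm_eq_abs, abs_of_nonneg h.1]
  rfl

end CyclicHolder

open CyclicHolder in
/-- **Stub `stub_cyclicHolder`** (line `Sketch`, crux stmt-QuantumFields-9736): the cyclic Hölder / chessboard
inequality `‖Tr ∏_{i<L} T_i u_i‖^L ≤ ∏_i Re Tr T_i^L` for positive definite `T_i`, unitary `u_i` and odd `L`,
from the mixed reflection step `h1` and the abstract chessboard argument `h2` (see the module docstring). -/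
theorem stub_cyclicHolder
    (h1 : ∀ {k α β : Type} [Fintype k] [DecidableEq k] (n : ℕ)
      (T : α → Matrix k k ℂ), (∀ a, (T a).PosSemidef) →
      ∀ (U : β → Matrix k k ℂ), (∀ b, U b ∈ Matrix.unitaryGroup k ℂ) →
      ∀ (e : β), U e = 1 → ∀ (ι : β → β), (∀ b, U (ι b) = (U b)ᴴ) →
      ∀ (c : ZMod (2 * n + 1) → α) (v : ZMod (2 * n + 1) → β),
      ‖((List.range (2 * n + 1)).map fun i : ℕ =>
            T (c (i : ZMod (2 * n + 1))) * U (v (i : ZMod (2 * n + 1)))).prod.trace‖ ^ 2 ≤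
        ‖((List.range (2 * n + 1)).map fun i : ℕ =>
            T ((fun j : ZMod (2 * n + 1) => if j.val ≤ n then c j else c (-j)) (i : ZMod (2 * n + 1))) *
              U ((fun j : ZMod (2 * n + 1) =>
                if j.val < n then v j else if j.val = n then e else ι (v (-1 - j))) (i : ZMod (2 * n + 1)))).prod.trace‖ *
        ‖((List.range (2 * n + 1)).map fun i : ℕ =>
            T ((fun j : ZMod (2 * n + 1) => if 0 < j.val ∧ j.val ≤ n then c (-j) else c j) (i : ZMod (2 * n + 1))) *
              U ((fun j : ZMod (2 * n + 1) =>
                if j.val < n then ι (v (-1 - j)) else if j.val = n then e else v j) (i : ZMod (2 * n + 1)))).prod.trace‖)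
    (h2 : ∀ {α β : Type} [Fintype α] [Fintype β] [DecidableEq α] [DecidableEq β]
      (n : ℕ) (F : (ZMod (2 * n + 1) → α) → (ZMod (2 * n + 1) → β) → ℝ), (∀ c v, 0 ≤ F c v) →
      ∀ (ν : α → ℝ), (∀ a, 0 < ν a) → ∀ (e : β) (ι : β → β), ι e = e →
      (∀ c v, F (fun j => c (j + 1)) (fun j => v (j + 1)) = F c v) →
      (∀ c v, F c v ^ 2 ≤
        F (fun j => if j.val ≤ n then c j else c (-j))
            (fun j => if j.val < n then v j else if j.val = n then e else ι (v (-1 - j))) *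
          F (fun j => if 0 < j.val ∧ j.val ≤ n then c (-j) else c j)
            (fun j => if j.val < n then ι (v (-1 - j)) else if j.val = n then e else v j)) →
      (∀ a, F (fun _ => a) (fun _ => e) = ν a) →
      ∀ (c : ZMod (2 * n + 1) → α) (v : ZMod (2 * n + 1) → β), F c v ^ (2 * n + 1) ≤ ∏ j, ν (c j))
    {k : Type} [Fintype k] [DecidableEq k] {L : ℕ} [NeZero L] (hL : Odd L)
    (T u : ZMod L → Matrix k k ℂ) (hT : ∀ i, (T i).PosDef) (hu : ∀ i, u i ∈ Matrix.unitaryGroup k ℂ) :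
    ‖((List.range L).map fun i : ℕ => T (i : ZMod L) * u (i : ZMod L)).prod.trace‖ ^ L ≤
      ∏ i : ZMod L, ((T i) ^ L).trace.re := by
  classical
  obtain ⟨n, rfl⟩ := hL
  -- degenerate index type: all traces vanish
  rcases isEmpty_or_nonempty k with hk | hk
  · simp [Matrix.trace_eq_zero_of_isEmpty]
  -- the letters: `T i` (indexed by `ZMod (2n+1)` itself) and `1, u i, (u i)ᴴ` (indexed by `Option (ZMod _ × Bool)`)
  let Uβ : Option (ZMod (2 * n + 1) × Bool) → Matrix k k ℂ := fun b =>
    match b with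
    | none => 1
    | some (i, false) => u i
    | some (i, true) => (u i)ᴴ
  let ι : Option (ZMod (2 * n + 1) × Bool) → Option (ZMod (2 * n + 1) × Bool) := fun b =>
    match b with
    | none => none
    | some (i, b) => some (i, !b)
  have hUβ : ∀ b, Uβ b ∈ Matrix.unitaryGroup k ℂ := by
    rintro (_ | ⟨i, _ | _⟩)
    · exact Submonoid.one_mem _
    · exact hu i
    · exact Unitary.star_mem (hu i)
  have hιU : ∀ b, Uβ (ι b) = (Uβ b)ᴴ := by
    rintro (_ | ⟨i, _ | _⟩)
    · exact Matrix.conjTranspose_one.symm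
    · rfl
    · exact (Matrix.conjTranspose_conjTranspose _).symm
  -- the functional and its homogeneous values
  let F : (ZMod (2 * n + 1) → ZMod (2 * n + 1)) → (ZMod (2 * n + 1) → Option (ZMod (2 * n + 1) × Bool)) → ℝ :=
    fun c v => ‖((List.range (2 * n + 1)).map fun i : ℕ =>
      T (c (i : ZMod (2 * n + 1))) * Uβ (v (i : ZMod (2 * n + 1)))).prod.trace‖
  let ν : ZMod (2 * n + 1) → ℝ := fun a => ((T a) ^ (2 * n + 1)).trace.re
  have hν : ∀ a, 0 < ν a := fun a => by
    have hpow : ((T a) ^ (2 * n + 1)).PosDef :=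
      ((hT a).posSemidef.pow _).posDef_iff_isUnit.mpr ((hT a).isUnit.pow _)
    have hpos := hpow.trace_pos
    rw [Complex.pos_iff] at hpos
    exact hpos.1
  have hrotF : ∀ c v, F (fun j => c (j + 1)) (fun j => v (j + 1)) = F c v := fun c v =>
    congrArg norm (trace_prod_map_range_succ (fun j => T (c j) * Uβ (v j)))
  have hreflF := fun c v => h1 n T (fun a => (hT a).posSemidef) Uβ hUβ none rfl ι hιU c v
  have hhomF : ∀ a, F (fun _ => a) (fun _ => none) = ν a := fun a => by
    show ‖((List.range (2 * n + 1)).map fun _ : ℕ => T a * (1 : Matrix k k ℂ)).prod.trace‖ = _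
    rw [List.map_const', List.length_range, List.prod_replicate, Matrix.mul_one]
    exact norm_trace_eq_re_of_posSemidef ((hT a).posSemidef.pow (2 * n + 1))
  exact h2 n F (fun c v => norm_nonneg _) ν hν none ι rfl hrotF hreflF hhomF (fun j => j)
    (fun j => some (j, false))

end Summit.QuantumFields.QCD.Cruxes.WilsonQuarkStability.FreeTangentLandauChessboard
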